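import Mathlib
import HarnessLib
import Literature.Analysis.FluidPDE.SuitableWeak
import Literature.Analysis.FluidPDE.SelfSimilar
import Literature.Analysis.FluidPDE.LocalTypeI
import Literature.Analysis.FluidPDE.SpaceTimeRescaling
import Literature.Analysis.FluidPDE.LocalTypeIScaling
import Literature.Analysis.FluidPDE.LocalTypeICongr
import Literature.Analysis.FluidPDE.LocalTypeIReverseZoom
import Literature.Analysis.FluidPDE.SlabTypeICompactness
import Literature.Analysis.FluidPDE.TypeIRateOseenMildRepresentative
import Summits.NavierStokesRegularity.NavierStokesRegularity.Theorems.RellichScarApexLocalisationSpherePersistence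
import Summits.NavierStokesRegularity.NavierStokesRegularity.Theorems.RellichScarApexLocalisationClassBlowupPersistence

/-!
# The Russian-doll tower (line russian-doll-multiplicity of crux `RellichScar.ApexLocalisation`,
# stub `stub_rdTower`)

**S4, the doll induction `T(m)`.**  If NO apex-class singular profile exists and S3
(`stub_rdLocalApex`, a hypothesis here) holds, every continuous rate-`C` class profile `w` with
`𝐈 ≤ I < ⊤` singular at the origin carries, inside every `Q_δ(0,0)`, `m` satellites
`‖w(τᵢ,yᵢ)‖ > 1/(ερ)`, `−ερ² < τᵢ < 0`, pairwise and from the origin `3ρ`-separated, `0 < ρ < δ`.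
Induction on `m`: (A) by S3, `w` is not locally apex at the origin; against the rate
`‖w‖ ≤ C/√(−t)` the failure points `(t_j, y_j)` satisfy `(j+1)√(−t_j) < ℓ_j := ‖y_j‖` and
`ℓ_j‖w(t_j,y_j)‖ > (j+2)/2` (`rdTower_satellite_ineq`); (B) `stub_classBlowupPersistence` with
scales `ℓ_j`, centres `y_j`, times `t_j/ℓ_j² → 0` gives an origin-singular continuous limit `v` of
class `(C, 4I)` of the images `ℓ w(ℓ² s, y + ℓ x)` in `L³(Q_R(0))`; (C) the induction hypothesis
gives `m` satellites of `v` in `Q_{1/10}`; (D) open point conditions at interior points of the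
continuous limit transfer to the images for `j` large (`rdTower_openTransfer`), within a common
margin;
(E) undoing the image and adding the head satellite `(t_j, y_j)` gives `T(m+1)` at scale `ℓρ`
(`rdTower_assemble`).  Reference for the compactness input: Albritton–Barker, J. Math. Fluid
Mech. 21 (2019), Lemma 2.2, Prop. 2.3, §3 [cite: AlbrittonBarker2019]; the tower is the lead's
form of the Russian-doll argument.
-/

noncomputable section

set_option linter.dupNamespace false

namespace Summit.NavierStokesRegularity.NavierStokesRegularity.Theorems.RellichScarApexLocalisation

open MeasureTheory Set Function Metric Filter Topology TopologicalSpace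
open scoped ENNReal NNReal
open Literature.Analysis Literature.Analysis.FluidPDE

local notation "E³" => EuclideanSpace ℝ (Fin 3)

/-- The open backward slab `(-∞, 0) × ℝ³` (time first). -/
local notation "𝕊" => Literature.Analysis.FluidPDE.slab (EuclideanSpace ℝ (Fin 3)) (Set.Iio (0 : ℝ)) isOpen_Iio

/-! ### (D) Open transfer: point conditions on a continuous limit persist along `L³_loc` limits -/

/-- **Open transfer.** If `W_j → v` in `L³(Q_R(0))`, `v` is continuous on the open backward slab,
`z₀ ∈ Q_R(0)` and `A < ‖v(z₀)‖`, then for all large `j` there is a point `z ∈ Q_R(0)` within `θ`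
of `z₀` with `A < ‖W_j(z)‖`: otherwise `‖W_j - v‖ ≥ κ := (‖v(z₀)‖ - A)/2` on a small ball around
`z₀`, so `‖W_j - v‖_{L³(Q_R(0))} ≥ κ |B|^{1/3} > 0` along a subsequence. [folklore] -/
theorem rdTower_openTransfer {W : ℕ → ℝ → E³ → E³} {v : ℝ → E³ → E³} {R A θ : ℝ} {z₀ : ℝ × E³}
    (hθ : 0 < θ) (hz₀ : z₀ ∈ parabolicCylinder R (0 : ℝ × E³))
    (hv : ContinuousOn (uncurry v) (Iio (0 : ℝ) ×ˢ univ))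
    (hconv : Tendsto (fun j => eLpNorm (uncurry (W j) - uncurry v) 3
      (volume.restrict (parabolicCylinder R (0 : ℝ × E³)))) atTop (𝓝 0))
    (hA : A < ‖v z₀.1 z₀.2‖) :
    ∀ᶠ j in atTop, ∃ z : ℝ × E³, dist z z₀ < θ ∧ z ∈ parabolicCylinder R (0 : ℝ × E³) ∧
      A < ‖W j z.1 z.2‖ := by
  have hz₀' : z₀ ∈ Iio (0 : ℝ) ×ˢ (univ : Set E³) := parabolicCylinder_origin_subset_slab R hz₀
  have hcont : ContinuousAt (uncurry v) z₀ :=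
    hv.continuousAt ((isOpen_Iio.prod isOpen_univ).mem_nhds hz₀')
  set κ : ℝ := (‖v z₀.1 z₀.2‖ - A) / 2 with hκ
  have hκ0 : 0 < κ := by rw [hκ]; linarith
  have hAκ : A + κ < ‖uncurry v z₀‖ := by change A + κ < ‖v z₀.1 z₀.2‖; rw [hκ]; linarith
  have h1 : ∀ᶠ z in 𝓝 z₀, A + κ < ‖uncurry v z‖ := hcont.norm.eventually (lt_mem_nhds hAκ)
  have h2 : ∀ᶠ z in 𝓝 z₀, z ∈ parabolicCylinder R (0 : ℝ × E³) :=
    (isOpen_parabolicCylinder R _).mem_nhds hz₀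
  have h3 : ∀ᶠ z in 𝓝 z₀, dist z z₀ < θ := ball_mem_nhds z₀ hθ
  obtain ⟨θ', hθ', hball⟩ := Metric.eventually_nhds_iff_ball.1 (h1.and (h2.and h3))
  have hsub : ball z₀ θ' ⊆ parabolicCylinder R (0 : ℝ × E³) := fun z hz => (hball z hz).2.1
  set K : ℝ≥0∞ := ENNReal.ofReal κ ^ (3 : ℝ) * volume (ball z₀ θ') with hK
  have hK0 : 0 < K :=
    ENNReal.mul_pos (ENNReal.rpow_pos_of_nonneg (ENNReal.ofReal_pos.2 hκ0) (by norm_num)).ne'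
      (Metric.measure_ball_pos volume z₀ hθ').ne'
  have hK3 : 0 < K ^ (1 / (3 : ℝ)) := ENNReal.rpow_pos_of_nonneg hK0 (by norm_num)
  filter_upwards [hconv.eventually (gt_mem_nhds hK3)] with j hj
  by_contra hcon
  push Not at hcon
  have hlow : K ≤ ∫⁻ z in parabolicCylinder R (0 : ℝ × E³),
      ‖(uncurry (W j) - uncurry v) z‖ₑ ^ (3 : ℝ) := by
    calc K = ∫⁻ _ in ball z₀ θ', ENNReal.ofReal κ ^ (3 : ℝ) := (setLIntegral_const _ _).symm
      _ ≤ ∫⁻ z in ball z₀ θ', ‖(uncurry (W j) - uncurry v) z‖ₑ ^ (3 : ℝ) := by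
          refine setLIntegral_mono' measurableSet_ball fun z hz => ?_
          obtain ⟨hz1, hz2, hz3⟩ := hball z hz
          refine ENNReal.rpow_le_rpow ?_ (by norm_num)
          rw [← ofReal_norm]
          refine ENNReal.ofReal_le_ofReal ?_
          change A + κ < ‖v z.1 z.2‖ at hz1
          change κ ≤ ‖W j z.1 z.2 - v z.1 z.2‖
          linarith [hcon z hz3 hz2, norm_sub_norm_le (v z.1 z.2) (W j z.1 z.2),
            norm_sub_rev (v z.1 z.2) (W j z.1 z.2)]
      _ ≤ _ := lintegral_mono_set hsub
  have hge : K ^ (1 / (3 : ℝ)) ≤ eLpNorm (uncurry (W j) - uncurry v) 3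
      (volume.restrict (parabolicCylinder R (0 : ℝ × E³))) := by
    rw [eLpNorm_eq_lintegral_rpow_enorm_toReal (by norm_num) (by simp), ENNReal.toReal_ofNat]
    exact ENNReal.rpow_le_rpow hlow (by norm_num)
  exact absurd hj (not_lt.2 hge)

/-! ### (A) The rate against the local-apex failure -/

/-- If `C₀ (n+2)/(a+b) < V ≤ C₀/b` with `C₀ ≥ 1`, `n, a ≥ 0`, `b > 0` (value `V = ‖w(t,y)‖` of a
non-locally-apex point against the rate, `a = ‖y‖`, `b = √(−t)`), then `(n+1) b < a` and
`a V > (n+2)/2`. [folklore] -/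
theorem rdTower_satellite_ineq {C₀ n a b V : ℝ} (hC₀ : 1 ≤ C₀) (hn : 0 ≤ n) (ha : 0 ≤ a)
    (hb : 0 < b) (h1 : C₀ * (n + 2) / (a + b) < V) (h2 : V ≤ C₀ / b) :
    (n + 1) * b < a ∧ (n + 2) / 2 < a * V := by
  have hab : 0 < a + b := by positivity
  have h3 : C₀ * (n + 2) / (a + b) < C₀ / b := h1.trans_le h2
  rw [div_lt_div_iff₀ hab hb] at h3
  have h5 : (n + 2) * b < a + b :=
    lt_of_mul_lt_mul_left (by linarith : C₀ * ((n + 2) * b) < C₀ * (a + b)) (by linarith)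
  have h6 : (n + 1) * b < a := by linarith
  refine ⟨h6, lt_of_le_of_lt ?_ (mul_lt_mul_of_pos_left h1 (lt_of_le_of_lt (by positivity) h6))⟩
  rw [← mul_div_assoc, div_le_div_iff₀ (by norm_num) hab]
  have hb' : b ≤ a := by nlinarith
  nlinarith [le_mul_of_one_le_right ha hC₀]

/-! ### (E) Assembling the tower of `w` from the head satellite and the transferred ones -/

/-- **Assembly of `T(m+1)`.**  Head satellite `(t₀, y₀)` of `w` with `‖y₀‖ = ℓ < δ/(n+1)`, `n ≥ 1`,
`−ερ² < t₀/ℓ² `, `ℓ ‖w(t₀,y₀)‖ > 1/(ερ)`; tail: the `m` satellites `(τᵢ, zᵢ)` of the limit (scale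
`ρ < 1/10`, inside `Q_{1/10}`) perturbed to `z'ᵢ` within a common margin `θ₀` and carrying the
value `ℓ ‖w(ℓ² s'ᵢ, y₀ + ℓ x'ᵢ)‖ > 1/(ερ)`.  Then `ρ' = ℓρ`, `τ' = (t₀, ℓ² s'ᵢ)`,
`y' = (y₀, y₀ + ℓ x'ᵢ)` is a tower `T(m+1)` of `w` inside `Q_δ`. [folklore] -/
theorem rdTower_assemble {m n : ℕ} {w : ℝ → E³ → E³} {ε δ ℓ ρ θ₀ t₀ : ℝ} {y₀ : E³}
    {τ : Fin m → ℝ} {z : Fin m → E³} {z' : Fin m → ℝ × E³}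
    (hε : 0 < ε) (hℓ : 0 < ℓ) (hy₀ : ‖y₀‖ = ℓ) (hℓδ : ℓ < δ / ((n : ℝ) + 1)) (hn : 1 ≤ n)
    (hρ : 0 < ρ) (hρ10 : ρ < 1 / 10)
    (ht₀1 : -(ε * ρ ^ 2) < t₀ / ℓ ^ 2) (ht₀2 : t₀ < 0) (hbig₀ : 1 / (ε * ρ) < ℓ * ‖w t₀ y₀‖)
    (hθ10 : θ₀ ≤ 1 / 10)
    (hsat : ∀ i, -(ε * ρ ^ 2) < τ i ∧ τ i < 0 ∧ ‖z i‖ < 1 / 10 ∧ 3 * ρ < ‖z i‖)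
    (hm1 : ∀ i, θ₀ ≤ (‖z i‖ - 3 * ρ) / 2) (hm2 : ∀ i, θ₀ ≤ τ i + ε * ρ ^ 2)
    (hm3 : ∀ i, θ₀ ≤ -τ i) (hm4 : ∀ i k, i ≠ k → θ₀ ≤ (‖z i - z k‖ - 3 * ρ) / 4)
    (hz'1 : ∀ i, |(z' i).1 - τ i| < θ₀) (hz'2 : ∀ i, ‖(z' i).2 - z i‖ < θ₀)
    (hz'big : ∀ i, 1 / (ε * ρ) < ℓ * ‖w (ℓ ^ 2 * (z' i).1) (y₀ + ℓ • (z' i).2)‖) :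
    ∃ ρ' : ℝ, 0 < ρ' ∧ ρ' < δ ∧ ∃ (τ' : Fin (m + 1) → ℝ) (y' : Fin (m + 1) → E³),
      (∀ i, -(ε * ρ' ^ 2) < τ' i ∧ τ' i < 0 ∧ ‖y' i‖ < δ ∧ 3 * ρ' < ‖y' i‖ ∧
        1 / (ε * ρ') < ‖w (τ' i) (y' i)‖) ∧
      (∀ i j, i ≠ j → 3 * ρ' < ‖y' i - y' j‖) := by
  have hn1 : (1 : ℝ) ≤ n := by exact_mod_cast hn
  have hℓδ' : ℓ * ((n : ℝ) + 1) < δ := (lt_div_iff₀ (by positivity)).1 hℓδ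
  have h2ℓ : 2 * ℓ < δ := by nlinarith
  have hℓδ1 : ℓ < δ := by linarith
  have hℓρ : ℓ * ρ < ℓ * (1 / 10) := mul_lt_mul_of_pos_left hρ10 hℓ
  -- norms of the perturbed positions
  have hxup : ∀ i, ‖(z' i).2‖ < 1 / 10 + θ₀ := fun i => by
    linarith [norm_sub_norm_le (z' i).2 (z i), hz'2 i, (hsat i).2.2.1]
  have hxlow : ∀ i, ‖z i‖ - θ₀ < ‖(z' i).2‖ := fun i => by
    linarith [norm_sub_norm_le (z i) (z' i).2, norm_sub_rev (z i) (z' i).2, hz'2 i]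
  have hyup : ∀ i, ‖y₀ + ℓ • (z' i).2‖ < 2 * ℓ := fun i => by
    calc ‖y₀ + ℓ • (z' i).2‖ ≤ ‖y₀‖ + ‖ℓ • (z' i).2‖ := norm_add_le _ _
      _ = ℓ + ℓ * ‖(z' i).2‖ := by rw [hy₀, norm_smul, Real.norm_of_nonneg hℓ.le]
      _ < ℓ + ℓ * 1 := by
          have : ‖(z' i).2‖ < 1 := by linarith [hxup i]
          linarith [mul_lt_mul_of_pos_left this hℓ]
      _ = 2 * ℓ := by ring
  have hylow : ∀ i, ℓ * (8 / 10) ≤ ‖y₀ + ℓ • (z' i).2‖ := fun i => by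
    have h := norm_sub_le (y₀ + ℓ • (z' i).2) (ℓ • (z' i).2)
    rw [add_sub_cancel_right, hy₀, norm_smul, Real.norm_of_nonneg hℓ.le] at h
    have : ℓ * ‖(z' i).2‖ ≤ ℓ * (2 / 10) :=
      mul_le_mul_of_nonneg_left (by linarith [hxup i]) hℓ.le
    linarith
  have htail_sep : ∀ i, 3 * ρ < ‖(z' i).2‖ := fun i => by
    have hθ₀ : 0 < θ₀ := (norm_nonneg _).trans_lt (hz'2 i)
    linarith [hm1 i, (hsat i).2.2.2, hxlow i]
  refine ⟨ℓ * ρ, by positivity, by linarith, Fin.cons t₀ (fun i => ℓ ^ 2 * (z' i).1),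
    Fin.cons y₀ (fun i => y₀ + ℓ • (z' i).2), ?_, ?_⟩
  · intro i
    induction i using Fin.cases with
    | zero =>
      simp only [Fin.cons_zero]
      refine ⟨?_, ht₀2, by rw [hy₀]; exact hℓδ1, by rw [hy₀]; linarith, ?_⟩
      · have h := (lt_div_iff₀ (by positivity : (0 : ℝ) < ℓ ^ 2)).1 ht₀1
        calc -(ε * (ℓ * ρ) ^ 2) = -(ε * ρ ^ 2) * ℓ ^ 2 := by ring
          _ < t₀ := h
      · rw [div_lt_iff₀ (by positivity)] at hbig₀ ⊢
        have e : ℓ * ‖w t₀ y₀‖ * (ε * ρ) = ‖w t₀ y₀‖ * (ε * (ℓ * ρ)) := by ring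
        linarith
    | succ i =>
      simp only [Fin.cons_succ]
      have h1 := hz'1 i
      rw [abs_sub_lt_iff] at h1
      refine ⟨?_, ?_, (hyup i).trans h2ℓ, by linarith [hylow i], ?_⟩
      · have hs : -(ε * ρ ^ 2) < (z' i).1 := by linarith [hm2 i]
        have h := mul_lt_mul_of_pos_left hs (by positivity : (0 : ℝ) < ℓ ^ 2)
        calc -(ε * (ℓ * ρ) ^ 2) = ℓ ^ 2 * (-(ε * ρ ^ 2)) := by ring
          _ < ℓ ^ 2 * (z' i).1 := h
      · have hs : (z' i).1 < 0 := by linarith [hm3 i]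
        exact mul_neg_of_pos_of_neg (by positivity) hs
      · have h := hz'big i
        rw [div_lt_iff₀ (by positivity)] at h ⊢
        have e : ℓ * ‖w (ℓ ^ 2 * (z' i).1) (y₀ + ℓ • (z' i).2)‖ * (ε * ρ) =
            ‖w (ℓ ^ 2 * (z' i).1) (y₀ + ℓ • (z' i).2)‖ * (ε * (ℓ * ρ)) := by ring
        linarith
  · intro i j hij
    induction i using Fin.cases with
    | zero =>
      induction j using Fin.cases with
      | zero => exact absurd rfl hij
      | succ j =>
        simp only [Fin.cons_zero, Fin.cons_succ]
        rw [sub_add_cancel_left, norm_neg, norm_smul, Real.norm_of_nonneg hℓ.le]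
        linarith [mul_lt_mul_of_pos_left (htail_sep j) hℓ]
    | succ i =>
      induction j using Fin.cases with
      | zero =>
        simp only [Fin.cons_zero, Fin.cons_succ]
        rw [add_sub_cancel_left, norm_smul, Real.norm_of_nonneg hℓ.le]
        linarith [mul_lt_mul_of_pos_left (htail_sep i) hℓ]
      | succ j =>
        simp only [Fin.cons_succ]
        have hij' : i ≠ j := fun h => hij (by rw [h])
        rw [add_sub_add_left_eq_sub, ← smul_sub, norm_smul, Real.norm_of_nonneg hℓ.le]
        have hθ₀ : 0 < θ₀ := (norm_nonneg _).trans_lt (hz'2 i)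
        have key : ‖z i - z j‖ - 2 * θ₀ < ‖(z' i).2 - (z' j).2‖ := by
          have e : z i - z j = ((z' i).2 - (z' j).2) - ((z' i).2 - z i) + ((z' j).2 - z j) := by
            abel
          have : ‖z i - z j‖ ≤
              ‖(z' i).2 - (z' j).2‖ + ‖(z' i).2 - z i‖ + ‖(z' j).2 - z j‖ := by
            rw [e]
            exact (norm_add_le _ _).trans (add_le_add (norm_sub_le _ _) le_rfl)
          linarith [hz'2 i, hz'2 j]
        have : 3 * ρ < ‖(z' i).2 - (z' j).2‖ := by linarith [hm4 i j hij']
        linarith [mul_lt_mul_of_pos_left this hℓ]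

/-! ### S4 — the Russian-doll tower -/

/-- **S4 (stub_rdTower), the doll induction.** Suppose NO apex-class singular profile exists and grant
S3. Then for every `m`, every class `(C, I)`, `I < ⊤`, every continuous rate-`C` suitable weak slab
profile with `𝐈 ≤ I` singular at the origin, and all `ε, δ > 0`, there are a scale `0 < ρ < δ` and `m`
SATELLITES `(τᵢ, yᵢ)` with `−ερ² < τᵢ < 0`, `‖yᵢ‖ < δ`, `‖w(τᵢ,yᵢ)‖ > 1/(ερ)`, pairwise and from the
origin `3ρ`-separated.  Induction on `m`: by S3 and the hypothesis the profile is not locally apex at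
the origin, so points `(t_j, y_j) → (0,0)` with `‖w(t_j,y_j)‖ (‖y_j‖ + √(−t_j)) > j` exist, and the rate
forces `√(−t_j) < C‖y_j‖/(j − C)`; `stub_classBlowupPersistence` with scales `‖y_j‖` and centres `y_j`
gives an origin-singular continuous limit (class `(C, 4I)`) of the images `‖y_j‖ w(‖y_j‖² s, y_j + ‖y_j‖ x)`;
the `m` satellites of the LIMIT (induction hypothesis at `4 I`, `δ = 1/10`) are interior points of a
continuous function, so they transfer to the images for `j` large (`L³(Q(0,R))` convergence), where
the point `(t_j/‖y_j‖², 0)` is an `(m+1)`-st satellite and the origin of `w` sits at distance `1`;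
undo the image. [cite: AlbrittonBarker2019, Lemma 2.2, Prop. 2.3 and §3] -/
theorem stub_rdTower :
    (¬ ∃ (C' : ℝ) (u : ℝ → E³ → E³) (p : ℝ → E³ → ℝ) (G : ℝ → E³ → E³ →L[ℝ] E³),
        IsSuitableWeakSolutionOn 𝕊 1 0 u p ∧ HasWeakSpatialGradientOn 𝕊 u G ∧
        typeIBound (Iio (0 : ℝ) ×ˢ univ) u p G < ⊤ ∧ HasTypeIDecay C' u ∧
        IsBackwardSingularPoint u 0) →
    (∀ (K r : ℝ) (I : ℝ≥0∞), I < ⊤ → 0 < r →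
      ∀ (w : ℝ → E³ → E³) (q : ℝ → E³ → ℝ) (H : ℝ → E³ → E³ →L[ℝ] E³),
        IsSuitableWeakSolutionOn 𝕊 1 0 w q → HasWeakSpatialGradientOn 𝕊 w H →
        typeIBound (Iio (0 : ℝ) ×ˢ univ) w q H ≤ I → IsBackwardSingularPoint w 0 →
        (∀ (t : ℝ) (x : E³), -r ^ 2 < t → t < 0 → ‖x‖ < r → ‖w t x‖ ≤ K / (‖x‖ + Real.sqrt (-t))) →
        ∃ (C' : ℝ) (u : ℝ → E³ → E³) (p : ℝ → E³ → ℝ) (G : ℝ → E³ → E³ →L[ℝ] E³),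
          IsSuitableWeakSolutionOn 𝕊 1 0 u p ∧ HasWeakSpatialGradientOn 𝕊 u G ∧
          typeIBound (Iio (0 : ℝ) ×ˢ univ) u p G < ⊤ ∧ HasTypeIDecay C' u ∧
          IsBackwardSingularPoint u 0) →
    ∀ (m : ℕ) (C : ℝ) (I : ℝ≥0∞), I < ⊤ →
      ∀ (w : ℝ → E³ → E³) (q : ℝ → E³ → ℝ) (H : ℝ → E³ → E³ →L[ℝ] E³),
        IsSuitableWeakSolutionOn 𝕊 1 0 w q → HasWeakSpatialGradientOn 𝕊 w H →
        typeIBound (Iio (0 : ℝ) ×ˢ univ) w q H ≤ I → HasTypeITimeDecay C w →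
        ContinuousOn (uncurry w) (Iio (0 : ℝ) ×ˢ univ) → IsBackwardSingularPoint w 0 →
        ∀ (ε δ : ℝ), 0 < ε → 0 < δ →
        ∃ ρ : ℝ, 0 < ρ ∧ ρ < δ ∧ ∃ (τ : Fin m → ℝ) (y : Fin m → E³),
          (∀ i, -(ε * ρ ^ 2) < τ i ∧ τ i < 0 ∧ ‖y i‖ < δ ∧ 3 * ρ < ‖y i‖ ∧
            1 / (ε * ρ) < ‖w (τ i) (y i)‖) ∧
          (∀ i j, i ≠ j → 3 * ρ < ‖y i - y j‖) := by
  intro hnot hloc m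
  induction m with
  | zero =>
    intro C I _ w _ _ _ _ _ _ _ _ ε δ _ hδ
    exact ⟨δ / 2, by positivity, by linarith, Fin.elim0, Fin.elim0, fun i => i.elim0,
      fun i => i.elim0⟩
  | succ m ih =>
    intro C I hI w q H hsw hwg hIle hC hcont hsing ε δ hε hδ
    -- ## (A) `w` is not locally apex at the origin
    have hA : ∀ K r : ℝ, 0 < r → ∃ t : ℝ, ∃ x : E³, -r ^ 2 < t ∧ t < 0 ∧ ‖x‖ < r ∧
        K / (‖x‖ + Real.sqrt (-t)) < ‖w t x‖ := by
      intro K r hr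
      by_contra h
      push Not at h
      exact hnot (hloc K r I hI hr w q H hsw hwg hIle hsing h)
    set C₀ : ℝ := max C 1 with hC₀
    have hC₀1 : 1 ≤ C₀ := le_max_right _ _
    have hCC₀ : C ≤ C₀ := le_max_left _ _
    choose t y ht1 ht2 hyr hbig using
      fun j : ℕ => hA (C₀ * ((j : ℝ) + 2)) (δ / ((j : ℝ) + 1)) (by positivity)
    -- consequences of the rate: `(j+1) √(−t_j) < ℓ_j` and `ℓ_j ‖w(t_j, y_j)‖ > (j+2)/2`
    have hsqrt : ∀ j : ℕ, 0 < Real.sqrt (-t j) := fun j => Real.sqrt_pos.2 (neg_pos.2 (ht2 j))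
    have hkey : ∀ j : ℕ, ((j : ℝ) + 1) * Real.sqrt (-t j) < ‖y j‖ ∧
        ((j : ℝ) + 2) / 2 < ‖y j‖ * ‖w (t j) (y j)‖ := fun j =>
      rdTower_satellite_ineq hC₀1 (Nat.cast_nonneg j) (norm_nonneg _) (hsqrt j) (hbig j)
        ((hC (t j) (ht2 j) (y j)).trans (div_le_div_of_nonneg_right hCC₀ (hsqrt j).le))
    set ℓ : ℕ → ℝ := fun j => ‖y j‖ with hℓdef
    have hℓ : ∀ j, 0 < ℓ j := fun j =>
      lt_trans (mul_pos (by positivity) (hsqrt j)) (hkey j).1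
    -- ## (B) the blow-up limit recentred at the satellites
    set s : ℕ → ℝ := fun j => t j / ℓ j ^ 2 with hsdef
    have hs : ∀ j, s j < 0 := fun j => div_neg_of_neg_of_pos (ht2 j) (pow_pos (hℓ j) 2)
    have hst : ∀ j, ℓ j ^ 2 * s j = t j := fun j => by
      have hne : ℓ j ^ 2 ≠ 0 := pow_ne_zero 2 (hℓ j).ne'
      show ℓ j ^ 2 * (t j / ℓ j ^ 2) = t j
      rw [← mul_div_assoc, mul_div_cancel_left₀ _ hne]
    have hs0 : Tendsto s atTop (𝓝 0) := by
      have hlow : ∀ j : ℕ, -(1 / ((j : ℝ) + 1)) ≤ s j := fun j => by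
        have hj0 : (0 : ℝ) ≤ j := Nat.cast_nonneg j
        have ht : 0 ≤ -t j := (neg_pos.2 (ht2 j)).le
        have hsq : (((j : ℝ) + 1) * Real.sqrt (-t j)) ^ 2 < ℓ j ^ 2 :=
          pow_lt_pow_left₀ (hkey j).1 (by positivity) two_ne_zero
        rw [mul_pow, Real.sq_sqrt ht] at hsq
        have h2 : ((j : ℝ) + 1) * (-t j) ≤ ((j : ℝ) + 1) ^ 2 * (-t j) :=
          mul_le_mul_of_nonneg_right (by nlinarith) ht
        have e : -s j = -t j / ℓ j ^ 2 := by simp only [hsdef, neg_div]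
        rw [neg_le, e, div_le_div_iff₀ (pow_pos (hℓ j) 2) (by positivity), one_mul]
        nlinarith
      refine tendsto_of_tendsto_of_tendsto_of_le_of_le ?_ tendsto_const_nhds hlow
        fun j => (hs j).le
      simpa using (tendsto_one_div_add_atTop_nhds_zero_nat (𝕜 := ℝ)).neg
    have hblow : Tendsto (fun k => ℓ k * ‖w (ℓ k ^ 2 * s k) (y k)‖) atTop atTop := by
      have h1 : Tendsto (fun k : ℕ => ((k : ℝ) + 2) / 2) atTop atTop :=
        (tendsto_atTop_add_const_right _ _ tendsto_natCast_atTop_atTop).atTop_div_const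
          (by norm_num)
      refine tendsto_atTop_mono (fun k => ?_) h1
      rw [hst k]
      exact (hkey k).2.le
    obtain ⟨σ, v, q', H', hσ, hswv, hwgv, hIv, hCv, hcontv, hsingv, hconv⟩ :=
      stub_classBlowupPersistence C I (fun _ => w) (fun _ => q) (fun _ => H) ℓ y s hI
        (fun _ => hsw) (fun _ => hwg) (fun _ => hIle) (fun _ => hC) (fun _ => hcont) hℓ hs hs0
        hblow
    -- ## (C) the induction hypothesis for the limit (class `(C, 4I)`, `δ = 1/10`)
    have h4I : 4 * I < ⊤ := ENNReal.mul_lt_top (by simp) hI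
    obtain ⟨ρ, hρ, hρ10, τ, z, hsat, hsep⟩ :=
      ih C (4 * I) h4I v q' H' hswv hwgv hIv hCv hcontv hsingv ε (1 / 10) hε (by norm_num)
    -- ## (D) a common margin and the transfer of the limit's satellites to the images
    obtain ⟨θ₀, hθ₀, hθ10, hm1, hm2, hm3, hm4⟩ : ∃ θ₀ : ℝ, 0 < θ₀ ∧ θ₀ ≤ 1 / 10 ∧
        (∀ i, θ₀ ≤ (‖z i‖ - 3 * ρ) / 2) ∧ (∀ i, θ₀ ≤ τ i + ε * ρ ^ 2) ∧ (∀ i, θ₀ ≤ -τ i) ∧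
        (∀ i k, i ≠ k → θ₀ ≤ (‖z i - z k‖ - 3 * ρ) / 4) := by
      have hev : ∀ {a : ℝ}, 0 < a → ∀ᶠ θ in 𝓝[>] (0 : ℝ), θ ≤ a := fun ha =>
        (eventually_le_nhds ha).filter_mono nhdsWithin_le_nhds
      have hpair : ∀ᶠ θ in 𝓝[>] (0 : ℝ), ∀ i k : Fin m, i ≠ k → θ ≤ (‖z i - z k‖ - 3 * ρ) / 4 := by
        refine eventually_all.2 fun i => eventually_all.2 fun k => ?_
        by_cases hik : i = k
        · exact Eventually.of_forall fun _ h => absurd hik h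
        · exact (hev (by linarith [hsep i k hik])).mono fun _ h _ => h
      obtain ⟨θ₀, h0, h1, h2, h3, h4, h5⟩ := ((eventually_mem_nhdsWithin (a := (0 : ℝ))
        (s := Ioi 0)).and ((hev (by norm_num : (0 : ℝ) < 1 / 10)).and
        ((eventually_all.2 fun i => hev (by linarith [(hsat i).2.2.2.1] :
          (0 : ℝ) < (‖z i‖ - 3 * ρ) / 2)).and
        ((eventually_all.2 fun i => hev (by linarith [(hsat i).1] : (0 : ℝ) < τ i + ε * ρ ^ 2)).and
        ((eventually_all.2 fun i => hev (by linarith [(hsat i).2.1] : (0 : ℝ) < -τ i)).and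
        hpair))))).exists
      exact ⟨θ₀, h0, h1, h2, h3, h4, h5⟩
    set R : ℝ := ε * ρ ^ 2 + 2 with hR
    have hRpos : 0 < R := by positivity
    have hερ : 0 ≤ ε * ρ ^ 2 := by positivity
    have hQmem : ∀ i, (τ i, z i) ∈ parabolicCylinder R (0 : ℝ × E³) := fun i => by
      obtain ⟨h1, h2, h3, -⟩ := hsat i
      refine mem_parabolicCylinder.2
        ⟨⟨show (0 : ℝ) - R ^ 2 < τ i by nlinarith [sq_nonneg (R - 1)], h2⟩, ?_⟩
      show dist (z i) (0 : E³) < R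
      rw [dist_zero_right]; linarith
    have hD : ∀ᶠ j in atTop, ∀ i : Fin m, ∃ z' : ℝ × E³, dist z' (τ i, z i) < θ₀ ∧
        z' ∈ parabolicCylinder R (0 : ℝ × E³) ∧
        1 / (ε * ρ) < ‖(ℓ (σ j) • stPull (ℓ (σ j) ^ 2) (ℓ (σ j)) 0 (y (σ j)) w) z'.1 z'.2‖ :=
      eventually_all.2 fun i => rdTower_openTransfer
        (W := fun j => ℓ (σ j) • stPull (ℓ (σ j) ^ 2) (ℓ (σ j)) 0 (y (σ j)) w)
        hθ₀ (hQmem i) hcontv (hconv R hRpos) (hsat i).2.2.2.2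
    have he1 : ∀ᶠ j in atTop, -(ε * ρ ^ 2) < s (σ j) :=
      (hs0.comp hσ.tendsto_atTop).eventually_const_lt (neg_lt_zero.2 (by positivity))
    have hσR : Tendsto (fun j => ((σ j : ℕ) : ℝ)) atTop atTop :=
      tendsto_natCast_atTop_atTop.comp hσ.tendsto_atTop
    have he2 : ∀ᶠ j in atTop, 1 / (ε * ρ) < ((σ j : ℝ) + 2) / 2 :=
      ((tendsto_atTop_add_const_right _ _ hσR).atTop_div_const (by norm_num)).eventually_gt_atTop _
    have he3 : ∀ᶠ j in atTop, 1 ≤ σ j := hσ.tendsto_atTop.eventually_ge_atTop 1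
    obtain ⟨j, hDj, hj1, hj2, hj3⟩ := (hD.and (he1.and (he2.and he3))).exists
    choose z' hz'd hz'Q hz'big using hDj
    -- ## (E) the new tower of `w`
    have hz'd' : ∀ i, |(z' i).1 - τ i| < θ₀ ∧ ‖(z' i).2 - z i‖ < θ₀ := fun i => by
      have h := hz'd i
      rwa [Prod.dist_eq, max_lt_iff, Real.dist_eq, dist_eq_norm] at h
    have hz'big' : ∀ i, 1 / (ε * ρ) <
        ℓ (σ j) * ‖w (ℓ (σ j) ^ 2 * (z' i).1) (y (σ j) + ℓ (σ j) • (z' i).2)‖ := fun i => by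
      have h := hz'big i
      rwa [smul_stPull_apply, zero_add, norm_smul, Real.norm_of_nonneg (hℓ _).le] at h
    exact rdTower_assemble hε (hℓ (σ j)) rfl (hyr (σ j)) hj3 hρ hρ10 hj1 (ht2 (σ j))
      (hj2.trans (hkey (σ j)).2) hθ10
      (fun i => ⟨(hsat i).1, (hsat i).2.1, (hsat i).2.2.1, (hsat i).2.2.2.1⟩) hm1 hm2 hm3 hm4
      (fun i => (hz'd' i).1) (fun i => (hz'd' i).2) hz'big'

end Summit.NavierStokesRegularity.NavierStokesRegularity.Theorems.RellichScarApexLocalisation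

end
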